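import Summits.MatrixMultiplication.MatrixMultiplication.Theorems.OutsiderSandwichColumnDisjointDelay
import HarnessLib

/-!
# Shared blocks: copies × column-multiplicity `≥ (4/3)^N` for sign-untwisted certificates

Route `OutsiderSandwich` (decomposition cell `decomp-mm`, lens 4 «minimal counterexample /
extremal reduction», gen 27), support for the aside leaf `BlockOneIsMM`
(stmt-MatrixMultiplication-27147); the cut of record `closes(LaserTangency, LaserMergeOptimal,
SummitIffLaserTangency)` is untouched.  Removes the column-disjointness hypothesis of
`OutsiderSandwichColumnDisjoint(Delay)` at the price of a multiplicity factor.

## Setting (general wiring, slice normal form of `OutsiderSandwichTwistSlices`)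

A restriction `⟨B⟩ ⊠ C₁^{⊠M} ≥ ⟨2,2,2⟩^{⊠N}` in slice normal form: copy `i` has `x`-leg map `A_i`
(into `2^M × 2^M` matrices) and blocks `(i, c) : v ↦ τ_c(A_i X) v`; the vector legs wire block
`b = (i, c)` to target column `d` through matrices `G_{b,d}` (`2^N × 2^M`) and `H_{b,d}`
(`2^M × 2^N`), with NO disjointness assumption — a block may feed several columns.  Of the
restriction identities `Σ_b G_{b,d} τ_c(A_i X) H_{b,d'} = δ_{d d'} X` ONLY THE DIAGONAL ones
(`d = d'`, hypothesis `diag`) are used here.  Block `b` SERVES column `d` if `G_{b,d} ≠ 0` and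
`H_{b,d} ≠ 0`; its column-multiplicity is the number of columns it serves; column-disjoint means
multiplicity `≤ 1`.

## Results

* `eight_pow_le_mul_card_mul_six_pow` — if every block serves at most `m` columns and every
  serving block is sign-untwisted, then **`8^N ≤ m · B · 6^M`**; at `M = N`:
  `B · m ≥ (4/3)^N` (`four_pow_le_mul_card_mul_three_pow`).  Proof: per column the serving
  blocks' `x`-leg maps are jointly injective (`four_pow_le_sum_finrank₂`), summing over columns
  counts block `b` with its multiplicity `≤ m`, and the capacity law bounds each copy by `6^M`.
* `exists_shared_or_twisted` — **extremal reading**: a sign-untwisted certificate with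
  `m · B · 6^M < 8^N` is impossible, so a certificate beating the symmetric core's `(4/3)^N` by a
  factor `F` (i.e. `B · 3^N · F ≤ 4^N`) inside the sign-untwisted world has a block serving MORE
  THAN `F` columns — block sharing (the direct-sum packing regime) is then the load-bearing
  resource, quantitatively.
* Honest limit (`diag_only_degenerate`): the diagonal identities alone admit the degenerate
  solution "one untwisted identity block serving all `2^N` columns" (`B = 1`, `m = 2^N`), so no
  bound using only `diag` can drop the factor `m`; pricing shared blocks properly needs the
  off-diagonal identities (cancellation of cross terms), not attempted here.

No definition, no instance, no Literature notion is introduced.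

## References

* M. Bläser, *Fast Matrix Multiplication*, Theory of Computing Graduate Surveys 5 (2013), §5–§7
  (restrictions; Schönhage's direct-sum packing). [Blaser2013]
* A. Schönhage, *Partial and total matrix multiplication*, SIAM J. Comput. 10 (1981)
  (the packing regime this file does not price). [Schonhage1981]
* J.-P. Serre, *Linear Representations of Finite Groups*, GTM 42 (1977), §2.3 (Burnside, inside
  the capacity law). [Serre1977]
-/

noncomputable section

open scoped BigOperators Matrix

set_option linter.dupNamespace false
set_option autoImplicit false

namespace Summit.MatrixMultiplication.MatrixMultiplication.Theorems.OutsiderSandwichSharedBlocks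

open Summit.MatrixMultiplication.MatrixMultiplication.Theorems.OutsiderSandwichTwistGluing
  Summit.MatrixMultiplication.MatrixMultiplication.Theorems.OutsiderSandwichTwistCapacity
  Summit.MatrixMultiplication.MatrixMultiplication.Theorems.OutsiderSandwichColumnDisjointDelay

universe u v

variable {N M : ℕ} {K : Type u} [Field K] {ι : Type v} [Fintype ι]

/-- **Sign-untwisted certificates: `8^N ≤ m · B · 6^M`** where `m` bounds the number of target
columns any single block serves.  Hypotheses: the DIAGONAL restriction identities `diag`, the
multiplicity bound `hm` (the columns served by a block lie in a set of size `≤ m`), and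
sign-untwistedness `hSU` of every block that serves some column. -/
theorem eight_pow_le_mul_card_mul_six_pow
    (A : ι → Matrix (Idx N) (Idx N) K →ₗ[K] Matrix (Idx M) (Idx M) K)
    (G : ι → Idx M → Idx N → Matrix (Idx N) (Idx M) K)
    (H : ι → Idx M → Idx N → Matrix (Idx M) (Idx N) K) (m : ℕ)
    (diag : ∀ (d : Idx N) (X : Matrix (Idx N) (Idx N) K),
      ∑ b : ι × Idx M, G b.1 b.2 d * ptrans b.2 (A b.1 X) * H b.1 b.2 d = X)
    (hm : ∀ b : ι × Idx M, ∃ D : Finset (Idx N), D.card ≤ m ∧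
      ∀ d, G b.1 b.2 d ≠ 0 → H b.1 b.2 d ≠ 0 → d ∈ D)
    (hSU : ∀ i c, (∃ d, G i c d ≠ 0 ∧ H i c d ≠ 0) →
      ∃ ε : K, ∀ X, ptrans c (A i X) = ε • A i X) :
    8 ^ N ≤ m * (Fintype.card ι * 6 ^ M) := by
  classical
  let rk : ι → ℕ := fun i => Module.finrank K (LinearMap.range (A i))
  -- `srv b d`: block `b` serves column `d`
  let srv : ι × Idx M → Idx N → Prop := fun b d => G b.1 b.2 d ≠ 0 ∧ H b.1 b.2 d ≠ 0
  let C : ι → Finset (Idx M) := fun i => Finset.univ.filter fun c => ∃ d, srv (i, c) d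
  -- (1) per column, only serving blocks contribute; they are jointly injective
  have hcol : ∀ d : Idx N, 4 ^ N ≤ ∑ b ∈ Finset.univ.filter (fun b => srv b d), rk b.1 := by
    intro d
    refine four_pow_le_sum_finrank₂ A (fun i c => G i c d) (fun i c => H i c d) _ fun X => ?_
    rw [Finset.sum_filter_of_ne]
    · exact diag d X
    · rintro b - hb
      by_contra hs
      simp only [srv, not_and_or, not_not] at hs
      rcases hs with h0 | h0 <;> simp [h0] at hb
  -- (2) summing over columns counts block `b` with its multiplicity `≤ m`
  have hsum : ∑ d : Idx N, ∑ b ∈ Finset.univ.filter (fun b => srv b d), rk b.1 ≤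
      m * ∑ i, (C i).card * rk i := by
    calc ∑ d : Idx N, ∑ b ∈ Finset.univ.filter (fun b => srv b d), rk b.1
        = ∑ b : ι × Idx M, (Finset.univ.filter fun d => srv b d).card * rk b.1 := by
          rw [Finset.sum_comm' (t' := Finset.univ)
            (s' := fun b => Finset.univ.filter fun d => srv b d)
            (h := fun d b => by simp)]
          exact Finset.sum_congr rfl fun b _ => by rw [Finset.sum_const, smul_eq_mul]
      _ ≤ ∑ b : ι × Idx M, (if ∃ d, srv b d then m * rk b.1 else 0) :=
          Finset.sum_le_sum fun b _ => by
            by_cases hb : ∃ d, srv b d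
            · rw [if_pos hb]
              obtain ⟨D, hDm, hD⟩ := hm b
              exact Nat.mul_le_mul_right _ ((Finset.card_le_card fun d hd =>
                hD d (Finset.mem_filter.1 hd).2.1 (Finset.mem_filter.1 hd).2.2).trans hDm)
            · rw [if_neg hb, Finset.filter_false_of_mem fun d _ hd => hb ⟨d, hd⟩]
              simp
      _ = ∑ i, ∑ c : Idx M, (if ∃ d, srv (i, c) d then m * rk i else 0) :=
          Fintype.sum_prod_type _
      _ = ∑ i, m * ((C i).card * rk i) := Finset.sum_congr rfl fun i _ => by
          rw [← Finset.sum_filter, Finset.sum_const, smul_eq_mul]; ring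
      _ = m * ∑ i, (C i).card * rk i := by rw [← Finset.mul_sum]
  -- (3) capacity law per copy
  have hcap : ∀ i, (C i).card * rk i ≤ 6 ^ M := fun i =>
    card_mul_finrank_le (LinearMap.range (A i)) (C i) fun c hc => by
      obtain ⟨ε, hε⟩ := hSU i c (Finset.mem_filter.1 hc).2
      exact ⟨ε, fun Y hY => by obtain ⟨X, rfl⟩ := LinearMap.mem_range.1 hY; exact hε X⟩
  calc 8 ^ N = 2 ^ N * 4 ^ N := by rw [← mul_pow]; norm_num
    _ = ∑ _d : Idx N, 4 ^ N := by rw [Finset.sum_const, Finset.card_univ, card_Idx, smul_eq_mul]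
    _ ≤ ∑ d : Idx N, ∑ b ∈ Finset.univ.filter (fun b => srv b d), rk b.1 :=
        Finset.sum_le_sum fun d _ => hcol d
    _ ≤ m * ∑ i, (C i).card * rk i := hsum
    _ ≤ m * ∑ _i : ι, 6 ^ M := Nat.mul_le_mul_left _ (Finset.sum_le_sum fun i _ => hcap i)
    _ = m * (Fintype.card ι * 6 ^ M) := by rw [Finset.sum_const, Finset.card_univ, smul_eq_mul]

/-- At equal levels: **`4^N ≤ m · B · 3^N`**, i.e. copies × column-multiplicity `≥ (4/3)^N` for
sign-untwisted certificates `⟨B⟩ ⊠ C₁^{⊠N} ≥ ⟨2^N, 2^N, 2^N⟩`. -/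
theorem four_pow_le_mul_card_mul_three_pow
    (A : ι → Matrix (Idx N) (Idx N) K →ₗ[K] Matrix (Idx N) (Idx N) K)
    (G H : ι → Idx N → Idx N → Matrix (Idx N) (Idx N) K) (m : ℕ)
    (diag : ∀ (d : Idx N) (X : Matrix (Idx N) (Idx N) K),
      ∑ b : ι × Idx N, G b.1 b.2 d * ptrans b.2 (A b.1 X) * H b.1 b.2 d = X)
    (hm : ∀ b : ι × Idx N, ∃ D : Finset (Idx N), D.card ≤ m ∧
      ∀ d, G b.1 b.2 d ≠ 0 → H b.1 b.2 d ≠ 0 → d ∈ D)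
    (hSU : ∀ i c, (∃ d, G i c d ≠ 0 ∧ H i c d ≠ 0) →
      ∃ ε : K, ∀ X, ptrans c (A i X) = ε • A i X) :
    4 ^ N ≤ m * (Fintype.card ι * 3 ^ N) := by
  have h8 := eight_pow_le_mul_card_mul_six_pow A G H m diag hm hSU
  rw [show (8 : ℕ) ^ N = 2 ^ N * 4 ^ N by rw [← mul_pow]; norm_num,
    show (6 : ℕ) ^ N = 2 ^ N * 3 ^ N by rw [← mul_pow]; norm_num,
    Nat.mul_left_comm (Fintype.card ι), Nat.mul_left_comm m] at h8
  exact Nat.le_of_mul_le_mul_left h8 (pow_pos two_pos N)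

/-- **Extremal reading: beyond the core rate a sign-untwisted certificate SHARES blocks.**  If
`m · B · 6^M < 8^N` then some serving block is genuinely twisted or some block serves more than
`m` columns. -/
theorem exists_shared_or_twisted
    (A : ι → Matrix (Idx N) (Idx N) K →ₗ[K] Matrix (Idx M) (Idx M) K)
    (G : ι → Idx M → Idx N → Matrix (Idx N) (Idx M) K)
    (H : ι → Idx M → Idx N → Matrix (Idx M) (Idx N) K) (m : ℕ)
    (diag : ∀ (d : Idx N) (X : Matrix (Idx N) (Idx N) K),
      ∑ b : ι × Idx M, G b.1 b.2 d * ptrans b.2 (A b.1 X) * H b.1 b.2 d = X)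
    (hlt : m * (Fintype.card ι * 6 ^ M) < 8 ^ N) :
    (∃ b : ι × Idx M, ∀ D : Finset (Idx N), D.card ≤ m →
        ∃ d, d ∉ D ∧ G b.1 b.2 d ≠ 0 ∧ H b.1 b.2 d ≠ 0) ∨
      ∃ i c, (∃ d, G i c d ≠ 0 ∧ H i c d ≠ 0) ∧
        ∀ ε : K, ∃ X, ptrans c (A i X) ≠ ε • A i X := by
  by_contra h
  rw [not_or] at h
  obtain ⟨hm, hSU⟩ := h
  refine absurd (eight_pow_le_mul_card_mul_six_pow A G H m diag (fun b => ?_) fun i c hic => ?_)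
    (not_le.2 hlt)
  · by_contra hb
    refine hm ⟨b, fun D hDm => ?_⟩
    by_contra hd
    refine hb ⟨D, hDm, fun d hG hH => ?_⟩
    by_contra hdD
    exact hd ⟨d, hdD, hG, hH⟩
  · by_contra hε
    refine hSU ⟨i, c, hic, fun ε => ?_⟩
    by_contra hX
    refine hε ⟨ε, fun X => ?_⟩
    by_contra hne
    exact hX ⟨X, hne⟩

/-- **Why the factor `m` cannot be dropped from `diag` alone**: the diagonal identities are
satisfied by ONE untwisted identity block (`B = 1`, `A = id`, block `c = 0`, `G = H = 1` on
every column) serving all `2^N` columns (the sum below is the same for every column `d`) — the off-diagonal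
identities are what such sharing violates. -/
theorem diag_only_degenerate (X : Matrix (Idx N) (Idx N) K) :
    ∑ b : PUnit.{v+1} × Idx N,
      (if b.2 = 0 then (1 : Matrix (Idx N) (Idx N) K) else 0) *
        ptrans b.2 (LinearMap.id (R := K) X) * (if b.2 = 0 then 1 else 0) = X := by
  classical
  rw [Fintype.sum_prod_type, Fintype.sum_unique, Finset.sum_eq_single_of_mem (0 : Idx N)
    (Finset.mem_univ _) fun c _ hc => by rw [if_neg hc, Matrix.zero_mul, Matrix.zero_mul]]
  rw [if_pos rfl, LinearMap.id_apply, ptrans_zero, Matrix.one_mul, Matrix.mul_one]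

end Summit.MatrixMultiplication.MatrixMultiplication.Theorems.OutsiderSandwichSharedBlocks
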